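import Summits.BirchSwinnertonDyer.BirchSwinnertonDyer.Theorems.KimAtThreeShallowEqDeepTraceDualLattice
import Summits.BirchSwinnertonDyer.BirchSwinnertonDyer.Theorems.KimAtThreeCyclotomicTwistedExpStarBound
import HarnessLib

/-!
# The TWISTED per-factor `exp*` VALUES on a good-anomalous row, from (S5b-tower):
# `p · exp*_{dw}(H¹(L_{w₀}, T_pW)) ⊆ P_w^loc · 𝒪_{w₀} = p · E_p(φ⁻¹) · 𝒪_{w₀}`

Cell `bsd-addord`, seat `bsd-addord-w2-acc3` (PROGRAMME PART 1b row (3), gen 8); `--supports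
stmt-BirchSwinnertonDyer-19679` (helper). Theorems only (local instances on `ℚ_v` EXACTLY as in w2-c4's
`KimAtThreeShallowEqDeepTraceDualLattice`, whose engine this file re-runs with a twisted exit); nothing closed or
booked; BSD / 19679 / 19599 / 20397 are not proved by any of this. CONDITIONAL on ONE Literature cite fact,
displayed: (S5b-tower) `PAdicHodge.exists_smul_range_expStarCoord_tower_iff_trace_log`.

WHY. Seat w2-c4 gen 11's road (2) for support item 20397 `FineKatoTauAnomalousThree` (good-ANOMALOUS `t = 0` rows
of 19599 / 19077 / 19679), step «combine acc3's Euler lattice lemma with (S5b-tower) to get the TWISTED per-factor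
bound». w2-c4's untwisted engine `forall_trace_prime_mul_expStarOmegaHom_mul_mem_of_facts` (p529935) stops at
«`Tr(p · exp*_{dw}(z) · o) ∈ 𝒪_v` for `o ∈ 𝒪_{w₀}`», using only the points `p𝒪_{w₀} ⊆ log_ω E(L_{w₀})`. On a
good-anomalous row the full lattice lemma `log_ω E(L_{w₀}) = E_p(φ)⁻¹𝒪_{w₀}` is available (acc3 gen 7 / kport J7 /
p535199), and its dual is the Euler-twisted lattice (gen 6, p537494):

* ★★ `forall_exists_prime_mul_expStarOmegaHom_eq_eulerTwistLoc_of_facts` — same binders as p529935 (hT₂, W, d,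
  hinj, hex, hdual, r, w₀, dw, hinjw, hexw, (RES_w)) plus the ROW (`3 ≤ p`, `p ∤ Δ_min`, `p ∣ a_p − 1`,
  `#E(ℚ_p)[p] = 1`) and the TAME LEVEL (`p ∤ m`, `u ≡ p`, `w·p ≡ 1`, `m = cycLevel p 0 r`): **for every
  `z ∈ H¹(L_{w₀}, T_pW)` there is `o ∈ 𝒪_{w₀}` with `p · exp*_{dw}(z) = p·o − a_p·(σ_w)_{w₀} o + (σ_w)_{w₀}((σ_w)_{w₀} o)`**,
  i.e. `p · exp*_{dw}(z) ∈ P_w^loc · 𝒪_{w₀}`. Proof: p529935's (S5b-tower) step (`exists_smul_ranges_of_facts` ⇒ ONE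
  rescaling `e ∈ 𝒪_v` with `range(exp*_{e•dw}) = (log_ω E(L_{w₀}))^∨`), then p537494
  `exists_eq_eulerTwistLoc_of_forall_trace_padicLog_mul_mem_of_algebra` (§4: polymorphic in the `ℚ`-algebra
  structure of `L_{w₀}`, since `CharZero L_{w₀}` is in scope here) in place of the points step, then `ℚ_v`-linearity of
  `(σ_w)_{w₀}` (`galAdicCompletionMap_algebraMap_adicCompletion`) to absorb `e`.

What the 20397 discharger still adds (Kato side): the transport of this bound along `S_w` to the datum's own
place, R-κ, and the semi-local assembly (p537494 `exists_mem_cycIntLattice_eulerTwist_eq_of_forall` /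
gen 6 `eulerTwist_mem_cycIntLattice_iff_forall`).

References: [Kato1993LNM1553] Ch. II §1.2.4, Thm. 1.4.1 (3)–(4); [BlochKato1990] §3 Prop. 3.8, Ex. 3.11;
[Kim2022StructureSelmer] Lemma 3.4, Cor. 3.5, §3.4.1; [SilvermanAEC2009] Thm. IV.6.4 (b), V.1.1;
[CasselsFrohlichANT1967] Ch. II §10 (10.2), Ch. VII §1.1.
-/


set_option autoImplicit false
-- the Theorems namespace of a single-conjunct summit repeats the summit name by design (D-0017)
set_option linter.dupNamespace false

noncomputable section

set_option linter.dupNamespace false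

noncomputable section

open scoped NumberField NNReal Classical
open Field ValuativeRel IsDedekindDomain NumberField
open Literature.NumberTheory.GaloisRepresentations
open Literature.NumberTheory.GaloisRepresentations.PeriodRingData
open Literature.NumberTheory.PAdicHodge
open Literature.NumberTheory.EllipticCurves WeierstrassCurve
open Literature.NumberTheory.EllipticCurves.FormalGroupChart (padicLogPointFiniteExt)
open Literature.NumberTheory.EllipticCurves.Kato2004.EulerSystemValues (cycLevel)
open Literature.NumberTheory.AdelicBaseChange
open Summit.BirchSwinnertonDyer.BirchSwinnertonDyer.Theorems.KimAtThreeDeepLowerExpStarOmega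
open Summit.BirchSwinnertonDyer.BirchSwinnertonDyer.Theorems.KimAtThreeDeepLowerExpStarOmegaPlace
open Summit.BirchSwinnertonDyer.BirchSwinnertonDyer.Theorems.KimAtThreeDeepUpperExpStarTowerRange
open Summit.BirchSwinnertonDyer.BirchSwinnertonDyer.Theorems.KimAtThreeDeepUpperExpStarUnit
open Summit.BirchSwinnertonDyer.BirchSwinnertonDyer.Theorems.KimAtThreeDeepUpperFactorFieldNorm
open Summit.BirchSwinnertonDyer.BirchSwinnertonDyer.Theorems.KimAtThreeDeepUpperTowerLattice
open Summit.BirchSwinnertonDyer.BirchSwinnertonDyer.Theorems.KimAtThreeSemiLocalTraceDualLocal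
open Summit.BirchSwinnertonDyer.BirchSwinnertonDyer.Theorems.KimAtThreePortSharedSATCore
  (exists_padicInt_coe_eq_of_norm_le_one)
open Summit.BirchSwinnertonDyer.BirchSwinnertonDyer.Theorems.KimAtThreeFineKatoPerFactorPlaces
  (three_mem_asIdeal_extension)
open Summit.BirchSwinnertonDyer.BirchSwinnertonDyer.Theorems.KPort
open Summit.BirchSwinnertonDyer.Rank1Residual.GaloisImage
open Summit.BirchSwinnertonDyer.Rank1Residual.GaloisImage.TameLevel (squarefree_cycLevel_zero)
open Summit.BirchSwinnertonDyer.Rank1Residual.Additive.LocalLog (padicLog)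
open Summit.BirchSwinnertonDyer.Rank1Residual.Additive Summit.BirchSwinnertonDyer.Rank1Residual.Additive.BallEval
open Literature.NumberTheory.EllipticCurves.Rank1Residual
open Literature.NumberTheory.EllipticCurves.FormalGroupChart
open Rat.HeightOneSpectrum


open Literature.NumberTheory.Automorphic (galAdicCompletionMap)
open Literature.NumberTheory.EllipticCurves.Kato2004.EulerSystemValues (sigma)
open Summit.BirchSwinnertonDyer.BirchSwinnertonDyer.Theorems.KimAtThreeSemiLocalTraceDualTwistLocal
  (sigma_smul_eq_self_of_mul_coe_eq_one)
open Summit.BirchSwinnertonDyer.BirchSwinnertonDyer.Theorems.KimAtThreeShallowEqDeepSharpLattice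

namespace Summit.BirchSwinnertonDyer.BirchSwinnertonDyer.Theorems.KimAtThreeCyclotomicTwistedExpStarValues

variable (p : ℕ) [hp : Fact p.Prime]

attribute [local instance] fact_natCast_mem_primesEquiv_symm
-- the tree's `ℚ`-algebra structure on `ℚ_v` first (see `KimAtThreeDeepUpperExpStarFacts`)
attribute [local instance 100000] NumberField.Place.instAlgebraCompletion
attribute [local instance] valuativeRelPlace topologicalSpacePlace
attribute [local instance] isNonarchimedeanLocalField_place charZero_place
attribute [local instance] padicAlgebraPlace fact_not_isUnit_place isAdicComplete_place

set_option backward.isDefEq.respectTransparency false in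
set_option maxHeartbeats 800000 in
/-- ★★ **The TWISTED per-factor `exp*` values on a good-anomalous row** (`m = cycLevel p 0 r` tame, `p ∤ m`;
`u ≡ p`, `w·p ≡ 1 (mod m)`): for `W/ℚ` globally minimal with `p ≥ 3`, `p ∤ Δ_min`, `a_p ≡ 1 (mod p)`,
`#E(ℚ_p)[p] = 1`, a local Néron line `d` at `v_p` with Prop-1.2.3 binders and `hdual`, a place `w₀ ∣ p` of
`ℚ(ζ_m)` and a line datum `dw` at `L_{w₀}` with (RES_w): **for every `z ∈ H¹(L_{w₀}, T_pW)` there is `o ∈ 𝒪_{w₀}`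
with `p · exp*_{dw}(z) = p·o − a_p·(σ_w)_{w₀} o + (σ_w)_{w₀}((σ_w)_{w₀} o)`** — `p · exp*_{dw}(z) ∈ P_w^loc · 𝒪_{w₀}`.
CONDITIONAL on (S5b-tower). [cite: Kato1993LNM1553, Ch. II §1.2.4, Thm. 1.4.1 (3)–(4)]
[cite: BlochKato1990, §3 Prop. 3.8, Ex. 3.11] [cite: Kim2022StructureSelmer, Lemma 3.4, Cor. 3.5 and §3.4.1] -/
theorem forall_exists_prime_mul_expStarOmegaHom_eq_eulerTwistLoc_of_facts
    (hT₂ : exists_smul_range_expStarCoord_tower_iff_trace_log)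
    (W : WeierstrassCurve ℚ) [W.IsElliptic] [W.IsGloballyMinimal]
    (hp3 : 3 ≤ p) (hΔ : ¬ (p : ℤ) ∣ WeierstrassCurve.minimalDiscriminantInt W)
    (hap : (p : ℤ) ∣ W.frobeniusTrace p - 1)
    (ht : Nat.card {Q : (W.baseChange ℚ_[p]).toAffine.Point // (p : ℕ) • Q = 0} = 1)
    (d : LocalNeronLineAt W p ((primesEquiv (R := 𝓞 ℚ)).symm ⟨p, hp.out⟩))
    (hinj : (bdRPeriodRingData (valuation_place_lt_one p ((primesEquiv (R := 𝓞 ℚ)).symm ⟨p, hp.out⟩))).CupLogInjective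
      (logCyclotomic p) (localRationalTateRep W p (galRestrictPlace ((primesEquiv (R := 𝓞 ℚ)).symm ⟨p, hp.out⟩))))
    (hex : ∀ z : contOneCocycles (localRationalTateRep W p (galRestrictPlace ((primesEquiv (R := 𝓞 ℚ)).symm ⟨p, hp.out⟩))).toTopRep,
      (bdRPeriodRingData (valuation_place_lt_one p ((primesEquiv (R := 𝓞 ℚ)).symm ⟨p, hp.out⟩))).HasDualExp (logCyclotomic p)
        (localRationalTateRep W p (galRestrictPlace ((primesEquiv (R := 𝓞 ℚ)).symm ⟨p, hp.out⟩))) fun σ => z.1 σ)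
    (hdual : ∀ a : ℚ_[p], (∃ y, expStarOmegaPadicAt d hinj hex
        (((Padic.adicCompletionEquiv (𝓞 ℚ) ⟨p, hp.out⟩).symm : (((primesEquiv (R := 𝓞 ℚ)).symm ⟨p, hp.out⟩).adicCompletion ℚ) →+* ℚ_[p])) y = a) ↔
      ∀ Q : (W.baseChange ℚ_[p]).toAffine.Point, ‖a * padicLog (W.baseChange ℚ_[p]) Q‖ ≤ 1)
    (r : Finset (HeightOneSpectrum (𝓞 ℚ)))
    (hpm : ¬ p ∣ cycLevel p 0 r) (u w' : (ZMod (cycLevel p 0 r))ˣ)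
    (hu : (u : ZMod (cycLevel p 0 r)) = (p : ZMod (cycLevel p 0 r)))
    (hw' : (w' : ZMod (cycLevel p 0 r)) * ((p : ℕ) : ZMod (cycLevel p 0 r)) = 1)
    (w₀ : ((primesEquiv (R := 𝓞 ℚ)).symm ⟨p, hp.out⟩).Extension (𝓞 (CyclotomicField (cycLevel p 0 r) ℚ))) :
    letI := LocalField.charZero_adicCompletion w₀.1
    letI := LocalField.adicCompletionPadicAlgebra w₀.1 p (Kw.prime_mem_asIdeal w₀)
    haveI : Fact (¬ IsUnit ((p : ℕ) : integerC (w₀.1.adicCompletion (CyclotomicField (cycLevel p 0 r) ℚ)))) := ⟨not_isUnit_natCast_integerC (LocalField.valuation_adicCompletion_natCast_lt_one w₀.1 p (Kw.prime_mem_asIdeal w₀))⟩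
    haveI := isAdicComplete_integerC_natCast (LocalField.valuation_adicCompletion_natCast_lt_one w₀.1 p (Kw.prime_mem_asIdeal w₀))
    ∀ (dw : LocalNeronLine W (LocalField.valuation_adicCompletion_natCast_lt_one w₀.1 p (Kw.prime_mem_asIdeal w₀)) ((galRestrictPlace ((primesEquiv (R := 𝓞 ℚ)).symm ⟨p, hp.out⟩)).comp (absGaloisRestrict (((primesEquiv (R := 𝓞 ℚ)).symm ⟨p, hp.out⟩).adicCompletion ℚ) (w₀.1.adicCompletion (CyclotomicField (cycLevel p 0 r) ℚ)))))
      (hinjw : (bdRPeriodRingData (LocalField.valuation_adicCompletion_natCast_lt_one w₀.1 p (Kw.prime_mem_asIdeal w₀))).CupLogInjective (logCyclotomic p) (localRationalTateRep W p ((galRestrictPlace ((primesEquiv (R := 𝓞 ℚ)).symm ⟨p, hp.out⟩)).comp (absGaloisRestrict (((primesEquiv (R := 𝓞 ℚ)).symm ⟨p, hp.out⟩).adicCompletion ℚ) (w₀.1.adicCompletion (CyclotomicField (cycLevel p 0 r) ℚ))))))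
      (hexw : ∀ z : contOneCocycles (localRationalTateRep W p ((galRestrictPlace ((primesEquiv (R := 𝓞 ℚ)).symm ⟨p, hp.out⟩)).comp (absGaloisRestrict (((primesEquiv (R := 𝓞 ℚ)).symm ⟨p, hp.out⟩).adicCompletion ℚ) (w₀.1.adicCompletion (CyclotomicField (cycLevel p 0 r) ℚ))))).toTopRep,
        (bdRPeriodRingData (LocalField.valuation_adicCompletion_natCast_lt_one w₀.1 p (Kw.prime_mem_asIdeal w₀))).HasDualExp (logCyclotomic p) (localRationalTateRep W p ((galRestrictPlace ((primesEquiv (R := 𝓞 ℚ)).symm ⟨p, hp.out⟩)).comp (absGaloisRestrict (((primesEquiv (R := 𝓞 ℚ)).symm ⟨p, hp.out⟩).adicCompletion ℚ) (w₀.1.adicCompletion (CyclotomicField (cycLevel p 0 r) ℚ))))) fun σ => z.1 σ),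
      (∀ h : (tateLocalRep W p (Sum.inr ((primesEquiv (R := 𝓞 ℚ)).symm ⟨p, hp.out⟩))).cohomology 1,
        expStarOmegaHom (LocalField.valuation_adicCompletion_natCast_lt_one w₀.1 p (Kw.prime_mem_asIdeal w₀)) ((galRestrictPlace ((primesEquiv (R := 𝓞 ℚ)).symm ⟨p, hp.out⟩)).comp (absGaloisRestrict (((primesEquiv (R := 𝓞 ℚ)).symm ⟨p, hp.out⟩).adicCompletion ℚ) (w₀.1.adicCompletion (CyclotomicField (cycLevel p 0 r) ℚ)))) dw hinjw hexw
          (ContinuousRep.cohomologyRes (tateLocalRep W p (Sum.inr ((primesEquiv (R := 𝓞 ℚ)).symm ⟨p, hp.out⟩))) (absGaloisRestrict (((primesEquiv (R := 𝓞 ℚ)).symm ⟨p, hp.out⟩).adicCompletion ℚ) (w₀.1.adicCompletion (CyclotomicField (cycLevel p 0 r) ℚ))) 1 h) =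
        algebraMap (((primesEquiv (R := 𝓞 ℚ)).symm ⟨p, hp.out⟩).adicCompletion ℚ) (w₀.1.adicCompletion (CyclotomicField (cycLevel p 0 r) ℚ)) (expStarOmegaAt d h)) →
      ∀ z, ∃ o ∈ (w₀.1.adicCompletionIntegers (CyclotomicField (cycLevel p 0 r) ℚ)),
        ((p : ℕ) : (w₀.1.adicCompletion (CyclotomicField (cycLevel p 0 r) ℚ))) * expStarOmegaHom (LocalField.valuation_adicCompletion_natCast_lt_one w₀.1 p (Kw.prime_mem_asIdeal w₀)) ((galRestrictPlace ((primesEquiv (R := 𝓞 ℚ)).symm ⟨p, hp.out⟩)).comp (absGaloisRestrict (((primesEquiv (R := 𝓞 ℚ)).symm ⟨p, hp.out⟩).adicCompletion ℚ) (w₀.1.adicCompletion (CyclotomicField (cycLevel p 0 r) ℚ)))) dw hinjw hexw z =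
          ((p : ℕ) : (w₀.1.adicCompletion (CyclotomicField (cycLevel p 0 r) ℚ))) * o - (W.frobeniusTrace p : (w₀.1.adicCompletion (CyclotomicField (cycLevel p 0 r) ℚ))) * galAdicCompletionMap (sigma (cycLevel p 0 r) w') (sigma_smul_eq_self_of_mul_coe_eq_one (cycLevel p 0 r) p hpm w' hw' w₀) o +
            galAdicCompletionMap (sigma (cycLevel p 0 r) w') (sigma_smul_eq_self_of_mul_coe_eq_one (cycLevel p 0 r) p hpm w' hw' w₀) (galAdicCompletionMap (sigma (cycLevel p 0 r) w') (sigma_smul_eq_self_of_mul_coe_eq_one (cycLevel p 0 r) p hpm w' hw' w₀) o) := by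
  intro dw hinjw hexw hres z
  letI := LocalField.charZero_adicCompletion w₀.1
  letI := LocalField.adicCompletionPadicAlgebra w₀.1 p (Kw.prime_mem_asIdeal w₀)
  haveI : Fact (¬ IsUnit ((p : ℕ) : integerC (w₀.1.adicCompletion (CyclotomicField (cycLevel p 0 r) ℚ)))) := ⟨not_isUnit_natCast_integerC (LocalField.valuation_adicCompletion_natCast_lt_one w₀.1 p (Kw.prime_mem_asIdeal w₀))⟩
  haveI := isAdicComplete_integerC_natCast (LocalField.valuation_adicCompletion_natCast_lt_one w₀.1 p (Kw.prime_mem_asIdeal w₀))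
  -- `Place.Completion (inr v₀)` is `ℚ_{v₀}` by `rfl`: read the packet's algebra structure on it
  letI instEF : Algebra (NumberField.Place.Completion (K := ℚ) (Sum.inr ((primesEquiv (R := 𝓞 ℚ)).symm ⟨p, hp.out⟩))) (w₀.1.adicCompletion (CyclotomicField (cycLevel p 0 r) ℚ)) :=
    inferInstanceAs (Algebra (((primesEquiv (R := 𝓞 ℚ)).symm ⟨p, hp.out⟩).adicCompletion ℚ) (w₀.1.adicCompletion (CyclotomicField (cycLevel p 0 r) ℚ)))
  -- a compatible `ℝ≥0`-valuation on `L_{w₀}` (the base-`p^{1/e}` norm of the synonym `Kwe`) and integrality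
  haveI hνc := Kwe.compatible_normValuation (p := p) (L := (CyclotomicField (cycLevel p 0 r) ℚ)) (w := w₀)
  haveI : (W.baseChange (w₀.1.adicCompletion (CyclotomicField (cycLevel p 0 r) ℚ))).IsIntegral
      ((NormedField.valuation : Valuation (Kwe p (CyclotomicField (cycLevel p 0 r) ℚ) w₀) ℝ≥0).comap
        (Kwe.toCompletion p (CyclotomicField (cycLevel p 0 r) ℚ) w₀).symm.toRingHom).integer :=
    Kw.isIntegral_baseChange_of_isGloballyMinimal _ W
  -- (S5b-tower): ONE rescaling `e`
  obtain ⟨e, he, hde, hrange⟩ := exists_smul_ranges_of_facts W p ((primesEquiv (R := 𝓞 ℚ)).symm ⟨p, hp.out⟩) (LocalField.valuation_adicCompletion_natCast_lt_one w₀.1 p (Kw.prime_mem_asIdeal w₀)) hT₂ d hinj hex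
    ((NormedField.valuation : Valuation (Kwe p (CyclotomicField (cycLevel p 0 r) ℚ) w₀) ℝ≥0).comap (Kwe.toCompletion p (CyclotomicField (cycLevel p 0 r) ℚ) w₀).symm.toRingHom)
    dw hinjw hexw hres (((Padic.adicCompletionEquiv (𝓞 ℚ) ⟨p, hp.out⟩).symm : (((primesEquiv (R := 𝓞 ℚ)).symm ⟨p, hp.out⟩).adicCompletion ℚ) →+* ℚ_[p]))
  -- the unit step: `e ∈ 𝒪_v`
  obtain ⟨heO, -⟩ := mem_integers_of_hdual_smul W p ((primesEquiv (R := 𝓞 ℚ)).symm ⟨p, hp.out⟩) d hinj hex _ hdual he hde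
  have hE0 : algebraMap (((primesEquiv (R := 𝓞 ℚ)).symm ⟨p, hp.out⟩).adicCompletion ℚ) (w₀.1.adicCompletion (CyclotomicField (cycLevel p 0 r) ℚ)) e ≠ 0 := (map_ne_zero _).mpr he
  have hEO : algebraMap (((primesEquiv (R := 𝓞 ℚ)).symm ⟨p, hp.out⟩).adicCompletion ℚ) (w₀.1.adicCompletion (CyclotomicField (cycLevel p 0 r) ℚ)) e ∈ (w₀.1.adicCompletionIntegers (CyclotomicField (cycLevel p 0 r) ℚ)) :=
    w₀.adicCompletionSemialgHom_image_adicCompletionIntegers ℚ (CyclotomicField (cycLevel p 0 r) ℚ) ⟨e, heO, rfl⟩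
  -- `exp*_{dw} z = E · a'` with `a' := exp*_{E•dw} z` in the trace dual of `log_ω E(L_{w₀})`
  have haa' : expStarOmegaHom (LocalField.valuation_adicCompletion_natCast_lt_one w₀.1 p (Kw.prime_mem_asIdeal w₀)) ((galRestrictPlace ((primesEquiv (R := 𝓞 ℚ)).symm ⟨p, hp.out⟩)).comp (absGaloisRestrict (((primesEquiv (R := 𝓞 ℚ)).symm ⟨p, hp.out⟩).adicCompletion ℚ) (w₀.1.adicCompletion (CyclotomicField (cycLevel p 0 r) ℚ)))) dw hinjw hexw z = algebraMap (((primesEquiv (R := 𝓞 ℚ)).symm ⟨p, hp.out⟩).adicCompletion ℚ) (w₀.1.adicCompletion (CyclotomicField (cycLevel p 0 r) ℚ)) e *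
      expStarOmegaHom (LocalField.valuation_adicCompletion_natCast_lt_one w₀.1 p (Kw.prime_mem_asIdeal w₀)) ((galRestrictPlace ((primesEquiv (R := 𝓞 ℚ)).symm ⟨p, hp.out⟩)).comp (absGaloisRestrict (((primesEquiv (R := 𝓞 ℚ)).symm ⟨p, hp.out⟩).adicCompletion ℚ) (w₀.1.adicCompletion (CyclotomicField (cycLevel p 0 r) ℚ)))) (dw.smul (algebraMap (((primesEquiv (R := 𝓞 ℚ)).symm ⟨p, hp.out⟩).adicCompletion ℚ) (w₀.1.adicCompletion (CyclotomicField (cycLevel p 0 r) ℚ)) e) ((map_ne_zero (algebraMap (((primesEquiv (R := 𝓞 ℚ)).symm ⟨p, hp.out⟩).adicCompletion ℚ) (w₀.1.adicCompletion (CyclotomicField (cycLevel p 0 r) ℚ)))).mpr he))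
        hinjw hexw z := by
    rw [expStarOmegaHom_apply, expStarOmegaHom_apply, expStarOmega_smul, ← mul_assoc, mul_inv_cancel₀ hE0, one_mul]
  have hdual' := (hrange (expStarOmegaHom (LocalField.valuation_adicCompletion_natCast_lt_one w₀.1 p (Kw.prime_mem_asIdeal w₀)) ((galRestrictPlace ((primesEquiv (R := 𝓞 ℚ)).symm ⟨p, hp.out⟩)).comp (absGaloisRestrict (((primesEquiv (R := 𝓞 ℚ)).symm ⟨p, hp.out⟩).adicCompletion ℚ) (w₀.1.adicCompletion (CyclotomicField (cycLevel p 0 r) ℚ))))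
      (dw.smul (algebraMap (((primesEquiv (R := 𝓞 ℚ)).symm ⟨p, hp.out⟩).adicCompletion ℚ) (w₀.1.adicCompletion (CyclotomicField (cycLevel p 0 r) ℚ)) e) ((map_ne_zero (algebraMap (((primesEquiv (R := 𝓞 ℚ)).symm ⟨p, hp.out⟩).adicCompletion ℚ) (w₀.1.adicCompletion (CyclotomicField (cycLevel p 0 r) ℚ)))).mpr he)) hinjw hexw z)).mp ⟨z, rfl⟩
  -- the TWISTED bound for `a' := exp*_{E•dw} z`: its trace pairing with EVERY `log_ω P'` is integral (`hdual'`)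
  have hx : ∀ P' : (W.baseChange (w₀.1.adicCompletion (CyclotomicField (cycLevel p 0 r) ℚ))).toAffine.Point,
      Algebra.trace (((primesEquiv (R := 𝓞 ℚ)).symm ⟨p, hp.out⟩).adicCompletion ℚ) (w₀.1.adicCompletion (CyclotomicField (cycLevel p 0 r) ℚ))
        (expStarOmegaHom (LocalField.valuation_adicCompletion_natCast_lt_one w₀.1 p (Kw.prime_mem_asIdeal w₀)) ((galRestrictPlace ((primesEquiv (R := 𝓞 ℚ)).symm ⟨p, hp.out⟩)).comp (absGaloisRestrict (((primesEquiv (R := 𝓞 ℚ)).symm ⟨p, hp.out⟩).adicCompletion ℚ) (w₀.1.adicCompletion (CyclotomicField (cycLevel p 0 r) ℚ)))) (dw.smul (algebraMap (((primesEquiv (R := 𝓞 ℚ)).symm ⟨p, hp.out⟩).adicCompletion ℚ) (w₀.1.adicCompletion (CyclotomicField (cycLevel p 0 r) ℚ)) e) ((map_ne_zero (algebraMap (((primesEquiv (R := 𝓞 ℚ)).symm ⟨p, hp.out⟩).adicCompletion ℚ) (w₀.1.adicCompletion (CyclotomicField (cycLevel p 0 r) ℚ)))).mpr he))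
          hinjw hexw z *
          padicLogPointFiniteExt ((NormedField.valuation : Valuation (Kwe p (CyclotomicField (cycLevel p 0 r) ℚ) w₀) ℝ≥0).comap (Kwe.toCompletion p (CyclotomicField (cycLevel p 0 r) ℚ) w₀).symm.toRingHom) (W.baseChange (w₀.1.adicCompletion (CyclotomicField (cycLevel p 0 r) ℚ))) p P') ∈
        ((primesEquiv (R := 𝓞 ℚ)).symm ⟨p, hp.out⟩).adicCompletionIntegers ℚ := by
    intro P'
    have h1 := hdual' P'
    rw [Kw.trace_adicCompletionPadicAlgebra_eq w₀ (Kw.prime_mem_asIdeal w₀)] at h1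
    exact mem_adicCompletionIntegers_of_norm_symm_le_one p _ h1
  obtain ⟨z', hz', hzeq⟩ :=
    KimAtThreeCyclotomicTwistedExpStarBound.exists_eq_eulerTwistLoc_of_forall_trace_padicLog_mul_mem_of_algebra
      (cycLevel p 0 r) p W hpm u w' hu hw' w₀ hp3 hΔ hap ht
      ((NormedField.valuation : Valuation (Kwe p (CyclotomicField (cycLevel p 0 r) ℚ) w₀) ℝ≥0).comap (Kwe.toCompletion p (CyclotomicField (cycLevel p 0 r) ℚ) w₀).symm.toRingHom)
      _ hx
  -- `exp*_{dw} z = E · a'` with `E ∈ 𝒪_{w₀}` and `(σ_w)_𝔓` is `ℚ_v`-linear: `p · exp*_{dw} z = P_w^loc (E · z')`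
  refine ⟨algebraMap (((primesEquiv (R := 𝓞 ℚ)).symm ⟨p, hp.out⟩).adicCompletion ℚ) (w₀.1.adicCompletion (CyclotomicField (cycLevel p 0 r) ℚ)) e * z', mul_mem hEO hz', ?_⟩
  have hS : ∀ y : (w₀.1.adicCompletion (CyclotomicField (cycLevel p 0 r) ℚ)),
      galAdicCompletionMap (sigma (cycLevel p 0 r) w') (sigma_smul_eq_self_of_mul_coe_eq_one (cycLevel p 0 r) p hpm w' hw' w₀)
        (algebraMap (((primesEquiv (R := 𝓞 ℚ)).symm ⟨p, hp.out⟩).adicCompletion ℚ) (w₀.1.adicCompletion (CyclotomicField (cycLevel p 0 r) ℚ)) e * y) =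
      algebraMap (((primesEquiv (R := 𝓞 ℚ)).symm ⟨p, hp.out⟩).adicCompletion ℚ) (w₀.1.adicCompletion (CyclotomicField (cycLevel p 0 r) ℚ)) e *
        galAdicCompletionMap (sigma (cycLevel p 0 r) w') (sigma_smul_eq_self_of_mul_coe_eq_one (cycLevel p 0 r) p hpm w' hw' w₀) y := by
    intro y
    rw [map_mul, galAdicCompletionMap_algebraMap_adicCompletion ((primesEquiv (R := 𝓞 ℚ)).symm ⟨p, hp.out⟩) (sigma (cycLevel p 0 r) w') w₀ w₀]
  rw [haa', hS, hS, mul_left_comm, hzeq]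
  ring

end Summit.BirchSwinnertonDyer.BirchSwinnertonDyer.Theorems.KimAtThreeCyclotomicTwistedExpStarValues

end
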